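import Mathlib.CategoryTheory.Filtered.Final
import Literature.AlgebraicGeometry.Motives.EtaleToProetCovers
import Literature.AlgebraicGeometry.Motives.EtaleToProetCechCover
import HarnessLib

/-!
# Bhatt–Scholze Cor. 5.1.6 from Lemma 4.2.4: presented covers from pro-étale affines over `W`

`EtaleToProetCechCover.lean` proves the pro-étale/étale comparison
`nonempty_addEquiv_sheafH_etaleToProetPullback` (Bhatt–Scholze Cor. 5.1.6) from the cofinality of
*presented covers* (`PresentedCover`) among the pro-étale covering sieves of pro-étale affines. This
file supplies that cofinality from the density of the pro-étale affines in `X_proét` (Lemma 4.2.4,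
"the topos `Shv(X_proét)` is generated by `X_proét^aff`" — whose printed proof is Thm. 2.3.4 —
carried, as everywhere in the tree, as the instance hypothesis
`[(proetAffineInclusion X).IsCoverDense (Scheme.ProEt.topology X)]`):

* `Fac`, `PieceIndex`, `PresentedCover.ofPieces` — **finitely many pro-étale affines
  `Y_a = lim_λ Y_{a,λ}` over `W = lim_i U_i` form a presented cover**: they are reindexed over the
  small cofiltered category of levels `i` with compatible factorizations `Y_a → Y_{a,λ_a} → U_i` of
  the `Y_a → W → U_i` (morphisms of pro-objects are represented levelwise: Stacks 01ZC, through the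
  tree's `ProetAffinePresentation.exists_proj_fac` / `exists_proj_comp_eq`), whose projections to
  `ι` and to each `Λ_a` are initial (`Functor.initial_of_exists_of_isCofiltered`);
* `exists_presentedCover_of_mem` — **under Lemma 4.2.4 every covering sieve of a pro-étale affine
  contains the pieces of a presented cover** (finitely many pro-étale affines in the sieve cover the
  quasi-compact `W`, `exists_finite_proetAffine_of_mem_proEtTopology`, and generate a covering
  sieve, `ofArrows_mem_proEtTopology`);
* `nonempty_addEquiv_sheafH_etaleToProetPullback_of_isCoverDense`,
  `ellAdicCohomology_limOneSequence_of_isCoverDense` — **Cor. 5.1.6 and Prop. 5.6.2 from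
  Lemma 4.2.4 alone.**

## References

* B. Bhatt, P. Scholze, *The pro-étale topology for schemes*, Astérisque 369 (2015)
  (arXiv:1309.1198, held): Lemma 4.2.4, Cor. 5.1.6 (proof, p. 30), Thm. 2.3.4, Prop. 5.6.2.
  [BhattScholze2015]
* The Stacks Project, Tag 01ZC (morphisms from a cofiltered limit into a scheme locally of finite
  presentation). [StacksProject]

## Design notes

* Theorems and real definitions only (D-0026). Lemma 4.2.4 is an instance hypothesis, never a
  named fact (cf. the module docstring of `EtaleToProetDensity.lean`: its proof, Thm. 2.3.4, is a
  theory absent from Mathlib).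
* `PieceIndex` is a hand-rolled small category (a full subcategory of a comma category of the
  product of the `Λ_a` over `ι`); the "moves" are `Fac.restrict`/`Fac.push`, `Fac.exists_common`
  and `PieceIndex.exists_lift`; initiality of the projection to `Λ_a` refines the `a`-th stage via
  `Function.update` on the family of targets.
* Mathlib searched: `Comma`, `Functor.initial_of_exists_of_isCofiltered`, `IsCofiltered.min/eq`,
  `Scheme.exists_π_app_comp_eq_of_locallyOfFinitePresentation` (behind the tree's
  `exists_proj_fac`); no reindexing of morphisms of pro-objects as level maps in Mathlib.
  Nothing restated.
-/

universe uS

open CategoryTheory Limits Opposite AlgebraicGeometry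

noncomputable section

namespace Literature.AlgebraicGeometry.Motives

variable {X : Scheme.{uS}}

/-! ### Presented covers from finitely many pro-étale affines over `W` (reindexing morphisms of
pro-objects, Stacks 01ZC) -/

section Pieces

variable {W : X.ProEt} (𝔭 : ProetAffinePresentation X W) {r : ℕ} (Y : Fin r → X.ProEt)
  (𝔮 : ∀ a, ProetAffinePresentation X (Y a)) (g : ∀ a, Y a ⟶ W)

/-- Abbreviation: `ν : X_ét → X_proét`. -/
local notation "ν" => etaleToProet X

/-- A **factorization** of `Y_a → W → U_i` through a stage `Y_{a,λ}` of the presentation of `Y_a`: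
`Y_a → Y_{a,λ} → U_i`. [cite: StacksProject, Tag 01ZC] -/
structure Fac (i : 𝔭.ι) (a : Fin r) where
  /-- the stage -/
  lam : (𝔮 a).ι
  /-- the level map `Y_{a,λ} → U_i` -/
  φ : (𝔮 a).diagram.obj lam ⟶ 𝔭.diagram.obj i
  /-- it factors `Y_a → W → U_i` -/
  comm : (𝔮 a).proj lam ≫ (ν).map φ = g a ≫ 𝔭.proj i

namespace Fac

variable {𝔭 Y 𝔮 g} {i i' : 𝔭.ι} {a : Fin r}

/-- Restrict a factorization to a deeper stage. [folklore] -/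
def restrict (F : Fac 𝔭 Y 𝔮 g i a) {μ : (𝔮 a).ι} (c : μ ⟶ F.lam) : Fac 𝔭 Y 𝔮 g i a where
  lam := μ
  φ := (𝔮 a).diagram.map c ≫ F.φ
  comm := by rw [Functor.map_comp, (𝔮 a).proj_comp_assoc, F.comm]

/-- `restrict` on stages (by `rfl`). [folklore] -/
@[simp] lemma restrict_lam (F : Fac 𝔭 Y 𝔮 g i a) {μ : (𝔮 a).ι} (c : μ ⟶ F.lam) :
    (F.restrict c).lam = μ := rfl

/-- `restrict` on level maps (by `rfl`). [folklore] -/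
@[simp] lemma restrict_φ (F : Fac 𝔭 Y 𝔮 g i a) {μ : (𝔮 a).ι} (c : μ ⟶ F.lam) :
    (F.restrict c).φ = (𝔮 a).diagram.map c ≫ F.φ := rfl

/-- Push a factorization forward along `U_i → U_{i'}`. [folklore] -/
def push (F : Fac 𝔭 Y 𝔮 g i a) (b : i ⟶ i') : Fac 𝔭 Y 𝔮 g i' a where
  lam := F.lam
  φ := F.φ ≫ 𝔭.diagram.map b
  comm := by rw [Functor.map_comp, ← Category.assoc, F.comm, Category.assoc, 𝔭.proj_comp]

variable (𝔭 Y 𝔮 g) in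
/-- **Factorizations exist** (Stacks 01ZC, existence). [cite: StacksProject, Tag 01ZC] -/
theorem nonempty (i : 𝔭.ι) (a : Fin r) : Nonempty (Fac 𝔭 Y 𝔮 g i a) := by
  obtain ⟨lam, φ, h⟩ := (𝔮 a).exists_proj_fac (𝔭.diagram.obj i) (g a ≫ 𝔭.proj i)
  exact ⟨⟨lam, φ, h⟩⟩

/-- **Two factorizations agree at a common deeper stage** (Stacks 01ZC, uniqueness).
[cite: StacksProject, Tag 01ZC] -/
theorem exists_common (F₁ F₂ : Fac 𝔭 Y 𝔮 g i a) :
    ∃ (μ : (𝔮 a).ι) (c₁ : μ ⟶ F₁.lam) (c₂ : μ ⟶ F₂.lam),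
      (𝔮 a).diagram.map c₁ ≫ F₁.φ = (𝔮 a).diagram.map c₂ ≫ F₂.φ := by
  let μ₀ := IsCofiltered.min F₁.lam F₂.lam
  have h : (𝔮 a).proj μ₀ ≫ (ν).map ((𝔮 a).diagram.map (IsCofiltered.minToLeft _ _) ≫ F₁.φ) =
      (𝔮 a).proj μ₀ ≫ (ν).map ((𝔮 a).diagram.map (IsCofiltered.minToRight _ _) ≫ F₂.φ) := by
    rw [Functor.map_comp, (𝔮 a).proj_comp_assoc, F₁.comm, Functor.map_comp,
      (𝔮 a).proj_comp_assoc, F₂.comm]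
  obtain ⟨μ, e, he⟩ := (𝔮 a).exists_proj_comp_eq _ _ _ h
  refine ⟨μ, e ≫ IsCofiltered.minToLeft _ _, e ≫ IsCofiltered.minToRight _ _, ?_⟩
  simpa only [Functor.map_comp, Category.assoc] using he

end Fac

/-- **The index category of the reindexed pieces**: a level `i` of `W` together with
factorizations `Y_a → Y_{a,λ_a} → U_i` of all `Y_a → W → U_i`. [cite: StacksProject, Tag 01ZC] -/
structure PieceIndex where
  /-- the level of `W` -/
  i : 𝔭.ι
  /-- the factorizations -/
  F : ∀ a, Fac 𝔭 Y 𝔮 g i a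

namespace PieceIndex

variable {𝔭 Y 𝔮 g}

/-- Morphisms of `PieceIndex`: level maps making the factorizations commute. [folklore] -/
@[ext]
structure Hom (k k' : PieceIndex 𝔭 Y 𝔮 g) where
  /-- the map of levels of `W` -/
  b : k.i ⟶ k'.i
  /-- the maps of stages -/
  c : ∀ a, (k.F a).lam ⟶ (k'.F a).lam
  /-- compatibility with the level maps -/
  w : ∀ a, (k.F a).φ ≫ 𝔭.diagram.map b = (𝔮 a).diagram.map (c a) ≫ (k'.F a).φ

/-- `PieceIndex` is a small category. [folklore] -/
instance : SmallCategory (PieceIndex 𝔭 Y 𝔮 g) where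
  Hom := Hom
  id k := ⟨𝟙 _, fun _ => 𝟙 _, fun a => by
    rw [CategoryTheory.Functor.map_id, CategoryTheory.Functor.map_id, Category.comp_id,
      Category.id_comp]⟩
  comp f f' := ⟨f.b ≫ f'.b, fun a => f.c a ≫ f'.c a, fun a => by
    rw [Functor.map_comp, ← Category.assoc, f.w, Category.assoc, f'.w, Functor.map_comp,
      Category.assoc]⟩
  id_comp f := by
    refine Hom.ext (Category.id_comp _) (funext fun a => ?_)
    exact Category.id_comp _
  comp_id f := by
    refine Hom.ext (Category.comp_id _) (funext fun a => ?_)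
    exact Category.comp_id _
  assoc f f' f'' := by
    refine Hom.ext (Category.assoc _ _ _) (funext fun a => ?_)
    exact Category.assoc _ _ _

/-- Components of identities (by `rfl`). [folklore] -/
@[simp] lemma id_b (k : PieceIndex 𝔭 Y 𝔮 g) : Hom.b (𝟙 k) = 𝟙 k.i := rfl

/-- Components of identities (by `rfl`). [folklore] -/
@[simp] lemma id_c (k : PieceIndex 𝔭 Y 𝔮 g) (a : Fin r) : Hom.c (𝟙 k) a = 𝟙 (k.F a).lam := rfl

/-- Components of composites (by `rfl`). [folklore] -/
@[simp] lemma comp_b {k k' k'' : PieceIndex 𝔭 Y 𝔮 g} (f : k ⟶ k') (f' : k' ⟶ k'') :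
    Hom.b (f ≫ f') = Hom.b f ≫ Hom.b f' := rfl

/-- Components of composites (by `rfl`). [folklore] -/
@[simp] lemma comp_c {k k' k'' : PieceIndex 𝔭 Y 𝔮 g} (f : k ⟶ k') (f' : k' ⟶ k'') (a : Fin r) :
    Hom.c (f ≫ f') a = Hom.c f a ≫ Hom.c f' a := rfl

/-- Extensionality of morphisms. [folklore] -/
lemma hom_ext {k k' : PieceIndex 𝔭 Y 𝔮 g} (f f' : k ⟶ k') (hb : Hom.b f = Hom.b f')
    (hc : ∀ a, Hom.c f a = Hom.c f' a) : f = f' :=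
  Hom.ext hb (funext hc)

/-- Restrict all factorizations of an index to deeper stages. [folklore] -/
abbrev restrict (k : PieceIndex 𝔭 Y 𝔮 g) (μ : ∀ a, (𝔮 a).ι) (c : ∀ a, μ a ⟶ (k.F a).lam) :
    PieceIndex 𝔭 Y 𝔮 g :=
  ⟨k.i, fun a => (k.F a).restrict (c a)⟩

/-- The restriction morphism. [folklore] -/
def restrictHom (k : PieceIndex 𝔭 Y 𝔮 g) (μ : ∀ a, (𝔮 a).ι) (c : ∀ a, μ a ⟶ (k.F a).lam) :
    k.restrict μ c ⟶ k :=
  ⟨𝟙 k.i, c, fun a => by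
    rw [CategoryTheory.Functor.map_id, Category.comp_id]
    rfl⟩

/-- Components of `restrictHom` (by `rfl`). [folklore] -/
@[simp] lemma restrictHom_b (k : PieceIndex 𝔭 Y 𝔮 g) (μ : ∀ a, (𝔮 a).ι)
    (c : ∀ a, μ a ⟶ (k.F a).lam) : Hom.b (k.restrictHom μ c) = 𝟙 k.i := rfl

/-- Components of `restrictHom` (by `rfl`). [folklore] -/
@[simp] lemma restrictHom_c (k : PieceIndex 𝔭 Y 𝔮 g) (μ : ∀ a, (𝔮 a).ι)
    (c : ∀ a, μ a ⟶ (k.F a).lam) (a : Fin r) : Hom.c (k.restrictHom μ c) a = c a := rfl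

/-- **Lifting along a level map** (the key move): given an index `k` and `b : i' → k.i`, there are
factorizations over `i'` mapping to `k` over `b` (existence at `i'`, then agreement with the
pushed-forward factorizations of `k` at deeper stages). [cite: StacksProject, Tag 01ZC] -/
theorem exists_lift (k : PieceIndex 𝔭 Y 𝔮 g) {i' : 𝔭.ι} (b : i' ⟶ k.i) :
    ∃ (F : ∀ a, Fac 𝔭 Y 𝔮 g i' a) (c : ∀ a, (F a).lam ⟶ (k.F a).lam),
      ∀ a, (F a).φ ≫ 𝔭.diagram.map b = (𝔮 a).diagram.map (c a) ≫ (k.F a).φ := by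
  have h : ∀ a, ∃ (F : Fac 𝔭 Y 𝔮 g i' a) (c : F.lam ⟶ (k.F a).lam),
      F.φ ≫ 𝔭.diagram.map b = (𝔮 a).diagram.map c ≫ (k.F a).φ := fun a => by
    obtain ⟨G⟩ := Fac.nonempty 𝔭 Y 𝔮 g i' a
    obtain ⟨μ, c₁, c₂, hc⟩ := Fac.exists_common (G.push b) (k.F a)
    refine ⟨G.restrict c₁, c₂, ?_⟩
    change ((𝔮 a).diagram.map c₁ ≫ G.φ) ≫ 𝔭.diagram.map b = _
    rw [Category.assoc]
    exact hc
  choose F c hc using h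
  exact ⟨F, c, hc⟩

/-- `PieceIndex` is nonempty. [folklore] -/
instance nonempty : Nonempty (PieceIndex 𝔭 Y 𝔮 g) := by
  obtain ⟨i⟩ := (IsCofiltered.nonempty : Nonempty 𝔭.ι)
  exact ⟨⟨i, fun a => (Fac.nonempty 𝔭 Y 𝔮 g i a).some⟩⟩

/-- **`PieceIndex` is cofiltered.** [cite: StacksProject, Tag 01ZC] -/
instance isCofilteredOrEmpty : IsCofilteredOrEmpty (PieceIndex 𝔭 Y 𝔮 g) where
  cone_objs k₁ k₂ := by
    -- move both to the common level `i₀`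
    obtain ⟨F₁, c₁, hc₁⟩ := k₁.exists_lift (IsCofiltered.minToLeft k₁.i k₂.i)
    obtain ⟨F₂, c₂, hc₂⟩ := k₂.exists_lift (IsCofiltered.minToRight k₁.i k₂.i)
    -- at the common level, equalize the two factorizations of each piece
    have h : ∀ a, ∃ (μ : (𝔮 a).ι) (d₁ : μ ⟶ (F₁ a).lam) (d₂ : μ ⟶ (F₂ a).lam),
        (𝔮 a).diagram.map d₁ ≫ (F₁ a).φ = (𝔮 a).diagram.map d₂ ≫ (F₂ a).φ := fun a =>
      Fac.exists_common (F₁ a) (F₂ a)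
    choose μ d₁ d₂ hd using h
    let k₀ : PieceIndex 𝔭 Y 𝔮 g := ⟨IsCofiltered.min k₁.i k₂.i, fun a => (F₁ a).restrict (d₁ a)⟩
    refine ⟨k₀, ⟨IsCofiltered.minToLeft _ _, fun a => d₁ a ≫ c₁ a, fun a => ?_⟩,
      ⟨IsCofiltered.minToRight _ _, fun a => d₂ a ≫ c₂ a, fun a => ?_⟩, trivial⟩
    · change ((𝔮 a).diagram.map (d₁ a) ≫ (F₁ a).φ) ≫ _ = _
      rw [Category.assoc, hc₁, Functor.map_comp, Category.assoc]
      rfl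
    · change ((𝔮 a).diagram.map (d₁ a) ≫ (F₁ a).φ) ≫ _ = _
      rw [hd, Category.assoc, hc₂, Functor.map_comp, Category.assoc]
      rfl
  cone_maps {k' k} f₁ f₂ := by
    -- equalize the level maps in `ι`, lift, then equalize the stage maps in each `Λ_a`
    obtain ⟨F, c, hc⟩ := k'.exists_lift (IsCofiltered.eqHom (Hom.b f₁) (Hom.b f₂))
    let k₁ : PieceIndex 𝔭 Y 𝔮 g := ⟨_, F⟩
    let h₀ : k₁ ⟶ k' := ⟨IsCofiltered.eqHom (Hom.b f₁) (Hom.b f₂), c, hc⟩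
    let μ : ∀ a, (𝔮 a).ι := fun a => IsCofiltered.eq (c a ≫ Hom.c f₁ a) (c a ≫ Hom.c f₂ a)
    let d : ∀ a, μ a ⟶ (k₁.F a).lam := fun a => IsCofiltered.eqHom (c a ≫ Hom.c f₁ a) (c a ≫ Hom.c f₂ a)
    refine ⟨k₁.restrict μ d, k₁.restrictHom μ d ≫ h₀, ?_⟩
    apply hom_ext
    · simp only [comp_b, restrictHom_b, Category.assoc]
      exact congrArg _ (IsCofiltered.eq_condition (Hom.b f₁) (Hom.b f₂))
    · intro a
      simp only [comp_c, restrictHom_c, Category.assoc]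
      exact IsCofiltered.eq_condition (c a ≫ Hom.c f₁ a) (c a ≫ Hom.c f₂ a)

/-- **`PieceIndex` is cofiltered.** [cite: StacksProject, Tag 01ZC] -/
instance isCofiltered : IsCofiltered (PieceIndex 𝔭 Y 𝔮 g) where

variable (𝔭 Y 𝔮 g) in
/-- The projection to the levels of `W`. [folklore] -/
def p : PieceIndex 𝔭 Y 𝔮 g ⥤ 𝔭.ι where
  obj k := k.i
  map f := Hom.b f

variable (𝔭 Y 𝔮 g) in
/-- The projection to the stages of `Y_a`. [folklore] -/
def q (a : Fin r) : PieceIndex 𝔭 Y 𝔮 g ⥤ (𝔮 a).ι where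
  obj k := (k.F a).lam
  map f := Hom.c f a

/-- **The projection to the levels of `W` is initial.** [cite: StacksProject, Tag 01ZC] -/
instance initial_p : (p 𝔭 Y 𝔮 g).Initial := by
  refine Functor.initial_of_exists_of_isCofiltered _ (fun i => ?_) (fun {i k} s s' => ?_)
  · exact ⟨⟨i, fun a => (Fac.nonempty 𝔭 Y 𝔮 g i a).some⟩, ⟨𝟙 i⟩⟩
  · obtain ⟨F, c, hc⟩ := k.exists_lift (IsCofiltered.eqHom s s')
    exact ⟨⟨_, F⟩, ⟨IsCofiltered.eqHom s s', c, hc⟩, IsCofiltered.eq_condition s s'⟩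

/-- **The projection to the stages of `Y_a` is initial.** [cite: StacksProject, Tag 01ZC] -/
instance initial_q (a : Fin r) : (q 𝔭 Y 𝔮 g a).Initial := by
  classical
  refine Functor.initial_of_exists_of_isCofiltered _ (fun lam => ?_) (fun {lam k} s s' => ?_)
  · obtain ⟨k₀⟩ := (inferInstance : Nonempty (PieceIndex 𝔭 Y 𝔮 g))
    -- refine the `a`-th stage below `lam`, the others trivially
    let θ : ∀ a', (𝔮 a').ι := Function.update (fun a' => (k₀.F a').lam) a lam
    let μ : ∀ a', (𝔮 a').ι := fun a' => IsCofiltered.min (k₀.F a').lam (θ a')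
    refine ⟨k₀.restrict μ (fun a' => IsCofiltered.minToLeft _ _), ⟨?_⟩⟩
    change IsCofiltered.min (k₀.F a).lam (θ a) ⟶ lam
    exact IsCofiltered.minToRight _ _ ≫ eqToHom (show θ a = lam by
      simp only [θ, Function.update_self])
  · -- equalize `s, s'` at the `a`-th stage, the others trivially
    let R : ∀ a', Σ lam' : (𝔮 a').ι, ((k.F a').lam ⟶ lam') × ((k.F a').lam ⟶ lam') :=
      Function.update (fun a' => ⟨(k.F a').lam, 𝟙 _, 𝟙 _⟩) a ⟨lam, s, s'⟩
    let μ : ∀ a', (𝔮 a').ι := fun a' => IsCofiltered.eq (R a').2.1 (R a').2.2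
    let d : ∀ a', μ a' ⟶ (k.F a').lam := fun a' => IsCofiltered.eqHom (R a').2.1 (R a').2.2
    refine ⟨k.restrict μ d, k.restrictHom μ d, ?_⟩
    change IsCofiltered.eqHom (R a).2.1 (R a).2.2 ≫ s = IsCofiltered.eqHom (R a).2.1 (R a).2.2 ≫ s'
    have hR : R a = ⟨lam, s, s'⟩ := by simp only [R, Function.update_self]
    rw [hR]
    exact IsCofiltered.eq_condition s s'

end PieceIndex

/-- **The presented cover given by finitely many pro-étale affines over `W`** whose maps to `W`
jointly generate a covering sieve: the pieces `Y_a = lim_λ Y_{a,λ}` are reindexed over the common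
cofiltered category `PieceIndex` of compatible factorizations `Y_{a,λ_a} → U_i` (Stacks 01ZC), with
the initial projections to `ι` and to each `Λ_a`. [cite: BhattScholze2015, Cor. 5.1.6 (proof);
StacksProject, Tag 01ZC] -/
def PresentedCover.ofPieces
    (hmem : Sieve.generate (Presieve.ofArrows (fun a : ULift.{uS + 1} (Fin r) => Y a.down)
      (fun a => g a.down)) ∈ Scheme.ProEt.topology X W) :
    PresentedCover 𝔭 where
  K := PieceIndex 𝔭 Y 𝔮 g
  p := PieceIndex.p 𝔭 Y 𝔮 g
  r := r
  diagram a := PieceIndex.q 𝔭 Y 𝔮 g a ⋙ (𝔮 a).diagram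
  isAffine a k := (𝔮 a).isAffine _
  τ a :=
    { app := fun k => (k.F a).φ
      naturality := fun k k' f => (PieceIndex.Hom.w f a).symm }
  V := Y
  ρ a :=
    { app := fun k => (𝔮 a).proj (k.F a).lam
      naturality := fun k k' f => by
        change 𝟙 _ ≫ (𝔮 a).proj (k'.F a).lam =
          (𝔮 a).proj (k.F a).lam ≫ (ν).map ((𝔮 a).diagram.map (PieceIndex.Hom.c f a))
        rw [Category.id_comp, (𝔮 a).proj_comp] }
  isLimit a := (Functor.Initial.isLimitWhiskerEquiv (PieceIndex.q 𝔭 Y 𝔮 g a) _).symm (𝔮 a).isLimit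
  hom := g
  comm a k := (k.F a).comm
  mem := hmem

/-- The pieces of `ofPieces` are the given `Y_a → W` (by `rfl`). [folklore] -/
@[simp] lemma PresentedCover.ofPieces_hom
    (hmem : Sieve.generate (Presieve.ofArrows (fun a : ULift.{uS + 1} (Fin r) => Y a.down)
      (fun a => g a.down)) ∈ Scheme.ProEt.topology X W) (a : Fin r) :
    (PresentedCover.ofPieces 𝔭 Y 𝔮 g hmem).hom a = g a := rfl

end Pieces


/-! ### Presented covers inside every covering sieve, from the density of pro-étale affines
(Bhatt–Scholze Lemma 4.2.4) -/

section Dense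

variable (X)

/-- **Under Lemma 4.2.4, every pro-étale covering sieve of a pro-étale affine `W` contains the
pieces of a presented cover.** A covering sieve of the affine (quasi-compact) `W` contains finitely
many pro-étale affines `Y_a → W`, jointly surjective, once pro-étale affines generate `X_proét`
(`exists_finite_proetAffine_of_mem_proEtTopology`); they generate a covering sieve
(`ofArrows_mem_proEtTopology`), and are reindexed into a presented cover by
`PresentedCover.ofPieces` (Stacks 01ZC). This is the use of Thm. 2.3.4 in the proof of
Cor. 5.1.6 ("a cofinal collection of covers of `U` in `X_proét` is obtained by taking cofiltered
limits of affine étale covers obtained via base change from some `U_i`"), in the form in which the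
tree carries Lemma 4.2.4 (the instance hypothesis
`[(proetAffineInclusion X).IsCoverDense (Scheme.ProEt.topology X)]`).
[cite: BhattScholze2015, Lemma 4.2.4 and Cor. 5.1.6 (proof)] -/
theorem exists_presentedCover_of_mem
    [(proetAffineInclusion X).IsCoverDense (Scheme.ProEt.topology X)]
    {W : X.ProEt} (𝔭 : ProetAffinePresentation X W) {S : Sieve W}
    (hS : S ∈ Scheme.ProEt.topology X W) :
    ∃ c : PresentedCover 𝔭, ∀ a, S (c.hom a) := by
  haveI : IsAffine W.left := isAffine_left_of_presentation 𝔭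
  obtain ⟨ι, hι, Wp, gp, hR, hs⟩ := exists_finite_proetAffine_of_mem_proEtTopology hS
  obtain ⟨r, ⟨e⟩⟩ := Finite.exists_equiv_fin ι
  let Y : Fin r → X.ProEt := fun a => (Wp (e.symm a)).obj
  let 𝔮 : ∀ a, ProetAffinePresentation X (Y a) := fun a => (Wp (e.symm a)).property.some
  let g : ∀ a, Y a ⟶ W := fun a => gp (e.symm a)
  haveI : ∀ a : Fin r, IsAffine (Y a).left := fun a => isAffine_left_of_presentation (𝔮 a)
  have hs' : ∀ x : W.left, ∃ (a : Fin r) (y : (Y a).left), (g a).left y = x := fun x => by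
    obtain ⟨i, y, hy⟩ := hs x
    refine ⟨e i, ?_⟩
    change ∃ y' : (Wp (e.symm (e i))).obj.left, (gp (e.symm (e i))).left y' = x
    rw [Equiv.symm_apply_apply]
    exact ⟨y, hy⟩
  have hmem₀ := ofArrows_mem_proEtTopology Y g hs'
  have hle : Presieve.ofArrows Y g ≤
      Presieve.ofArrows (fun a : ULift.{uS + 1} (Fin r) => Y a.down) (fun a => g a.down) := by
    rintro Z f ⟨a⟩
    exact Presieve.ofArrows.mk (ULift.up a)
  have hmem : Sieve.generate (Presieve.ofArrows (fun a : ULift.{uS + 1} (Fin r) => Y a.down)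
      (fun a => g a.down)) ∈ Scheme.ProEt.topology X W :=
    (Scheme.ProEt.topology X).superset_covering (Sieve.giGenerate.gc.monotone_l hle) hmem₀
  exact ⟨PresentedCover.ofPieces 𝔭 Y 𝔮 g hmem, fun a => hR (e.symm a)⟩

end Dense

end Literature.AlgebraicGeometry.Motives

end

namespace Literature.AlgebraicGeometry.Motives

universe uD

/-- **Bhatt–Scholze Cor. 5.1.6 from Lemma 4.2.4 alone.** The named fact
`nonempty_addEquiv_sheafH_etaleToProetPullback` — `Hⁱ(X_ét, F) ≃ Hⁱ(X_proét, ν*F)` for all schemes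
`X`, abelian étale sheaves `F` and `i` — follows from the density of the pro-étale affines in
`X_proét` (Lemma 4.2.4, "the topos `Shv(X_proét)` is generated by `X_proét^aff`", whose printed
proof is Thm. 2.3.4), in the tree's instance-hypothesis form: input (B) is
`subsingleton_sheafH_uliftEtSheaf_of_injective`, input (A) is Cartan's criterion on the presented
covers (`etaleToProetPullbackULift_mem_etaleAcyclic_of_cofinal`) fed by
`exists_presentedCover_of_mem`. [cite: BhattScholze2015, Cor. 5.1.6, Lemma 4.2.4, Thm. 2.3.4] -/
theorem nonempty_addEquiv_sheafH_etaleToProetPullback_of_isCoverDense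
    [∀ X : Scheme.{uD}, (proetAffineInclusion X).IsCoverDense (Scheme.ProEt.topology X)] :
    nonempty_addEquiv_sheafH_etaleToProetPullback.{uD} :=
  nonempty_addEquiv_sheafH_etaleToProetPullback_of_cofinal fun X W hW S hS => by
    obtain ⟨𝔭⟩ := hW
    obtain ⟨c, hc⟩ := exists_presentedCover_of_mem X 𝔭 hS
    exact ⟨𝔭, c, hc⟩

/-- **Prop. 5.6.2 (`ellAdicCohomology_limOneSequence`) from Lemma 4.2.4 alone.**
[cite: BhattScholze2015, Prop. 5.6.2, Cor. 5.1.6, Lemma 4.2.4] -/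
theorem ellAdicCohomology_limOneSequence_of_isCoverDense
    [∀ X : Scheme.{uD}, (proetAffineInclusion X).IsCoverDense (Scheme.ProEt.topology X)] :
    ellAdicCohomology_limOneSequence.{uD} :=
  ellAdicCohomology_limOneSequence_of_cofinal fun X W hW S hS => by
    obtain ⟨𝔭⟩ := hW
    obtain ⟨c, hc⟩ := exists_presentedCover_of_mem X 𝔭 hS
    exact ⟨𝔭, c, hc⟩

end Literature.AlgebraicGeometry.Motives
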